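import Literature.MathematicalPhysics.QuantumFieldTheory.BalabanImbrieJaffe1984to88.BIJ88ChiTDerivN309
import Literature.MathematicalPhysics.QuantumFieldTheory.BalabanImbrieJaffe1984to88.BIJ88GaussFactor309
import Mathlib.Probability.Distributions.Gaussian.Real
import Mathlib.Probability.Moments.Basic

/-!
# `BalabanImbrieJaffe1984to88.BIJ88GaussIntegration309` — T. Bałaban, J. Imbrie, A. Jaffe, *Effective action and cluster properties of
the abelian Higgs model*, Commun. Math. Phys. **114** (1988) 257–315 [BalabanImbrieJaffe1988]: p. 309 [PDF 53] (Sect. 5.14, proof of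
(5.14.4)), the clause *"After integration over A^{(k)}, we obtain factors ct^{−n}e^{−cp(te_k)²}"* — the Gaussian integration that
PRODUCES the left side of the printed inequality `ct^{−n}e^{−cp(te_k)²} ≤ (e^β(L^kε/ε₀)^{1/4−α})ⁿ` (the inequality itself is
`BIJ88GaussFactor309.gauss309`, p36 gen 4; the integrand bound *"t^{−n} times a function bounded by a constant and supported in
c₁p(te_k) ≤ |A^{(k)}| ≤ c₂p(te_k)"* is `BIJ88ChiTDerivN309`, p36 gen 5).

MODEL INSTANCE (stated as such): the integration variable is ONE real Gaussian variable `A` of mean `m` and variance `v` — the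
single-bond marginal of the (uncentered, normalized — p. 302) Gaussian measure `⟨·⟩_{s_Γ}` of (5.13.3) in which (5.14.3) is an
expectation — realised as Mathlib's `ProbabilityTheory.gaussianReal m v`.  MECHANISM: the n-th t-derivative of the χ-factor is
`≤ C t^{−n}` and vanishes unless `(9/10)|c|p(te_k) ≤ |A| ≤ |c|p(te_k)` (`BIJ88ChiTDerivN309`), and the Gaussian measure of the event
`|A| ≥ a` is `≤ 2e^{−(a−|m|)²/(2v)}` (Chernoff: Mathlib `ProbabilityTheory.measure_ge_le_exp_cgf` with `cgf_gaussianReal`, optimised at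
`τ = (a∓m)/v`).  Hence `∫ |(d/dt)ⁿχ(c·p(te_k),A)| dγ_{m,v}(A) ≤ 2C·t^{−n}·e^{−((9/10)|c|p(te_k)−|m|)²/(2v)}`; for `m = 0` this is
`(2C)/tⁿ · e^{−(81c²/(200v))·p(te_k)²}` — the printed `ct^{−n}e^{−cp(te_k)²}` with both constants explicit — and `gauss309` carries it to
`(e^β(L^kε/ε₀)^{1/4−α})ⁿ` in the paper's small-coupling regime.

statement-level skeleton of published theorems with citation tags; proofs where landed; nothing here is a claim about the Yang–Mills mass gap

PDF held: `paper:balaban1988-cmp114-bij-abelian-higgs-effective-action` (journal page = PDF page + 256).  Page read as image: PDF p. 53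
(journal 309), `g4png.py` ×2 render (seat folder `renders/original-p053-x2.png`).

CITATION HEADER (lean-in-tree rule).  Part of the lit-balaban TYPED SKELETON (HOME `run/shared/lean/pub/lit-balaban/`), Phase 2,
seat p36 (gen 5, unit `lit-balaban-p36`); row **C2.Eq5.14.3-5.14.4** of `HOME/lit-balaban-r16/ROWS-C2-part2.md`.  WHAT IS REPRODUCED
(theorem-only; no definitions, no `Prop` facts; axioms standard):
* `gaussianReal_real_ge_le` / `gaussianReal_real_le_neg_le` / **`gaussianReal_real_abs_ge_le`** — Gaussian tails:
  `γ_{m,v}{a ≤ x} ≤ e^{−(a−m)²/(2v)}` (`m ≤ a`), `γ_{m,v}{x ≤ −a} ≤ e^{−(a+m)²/(2v)}` (`−a ≤ m`), `γ_{m,v}{a ≤ |x|} ≤ 2e^{−(a−|m|)²/(2v)}` (`|m| ≤ a`);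
* **`exists_integral_abs_iteratedDeriv_cutoff_t_le`** (`n ≥ 1`): `∃ C = C(χ,p,n) ≥ 0` with
  `∫ |(d/dt)ⁿχ(c·p(te_k),A)| dγ_{m,v}(A) ≤ 2C·t^{−n}·e^{−((9/10)|c|p(te_k)−|m|)²/(2v)}` for `c ≠ 0`, `0 < e_k`, `0 < t`, `te_k ≤ e^{−1}`,
  `|m| ≤ (9/10)|c|p(te_k)`;
* **`exists_integral_abs_iteratedDeriv_cutoff_t_le_centered`** (`m = 0`): `≤ (2C)/tⁿ · e^{−((81/200)c²/v)·p(te_k)²}`;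
* **`exists_integral_le_vertexFactor_pow`**: chained with `BIJ88GaussFactor309.gauss309` — `≤ (e^β s^{1/4−α})ⁿ`, `L^kε = sε₀`, under that
  theorem's printed regime (`n + 1 ≤ (81c²/(200v))|log e_k⁻¹|^{2p−1}`, `2C·e_k ≤ 1`, `e_k ≤ e^{−1}`, `0 < t ≤ 1`).
NOT here: (5.14.3)–(5.14.4) themselves; the simultaneous treatment of several (d/dt)-factors and of φ^{(k)} (*"Similar bounds hold for φ^{(k)}"*).
-/

namespace Literature.MathematicalPhysics.QuantumFieldTheory.BalabanImbrieJaffe1984to88.BIJ88GaussIntegration309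

open MeasureTheory ProbabilityTheory
open BIJ88Sect2Statements (pLog eK)
open BIJ88Sect5Statements (CutoffProfile cutoff)
open scoped NNReal

/-! ## §1 Gaussian tails (Chernoff) -/

section Tails

/-- Upper Gaussian tail: for `m ≤ a`, `γ_{m,v}{x : a ≤ x} ≤ e^{−(a−m)²/(2v)}` (Chernoff at `τ = (a−m)/v`; for `v = 0` both sides read with
Lean's `x/0 = 0`, the bound being `1`). [cite: BalabanImbrieJaffe1988, (5.14.4) p.309] -/
theorem gaussianReal_real_ge_le (m : ℝ) (v : ℝ≥0) {a : ℝ} (ha : m ≤ a) :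
    (gaussianReal m v).real {x | a ≤ x} ≤ Real.exp (-(a - m) ^ 2 / (2 * v)) := by
  by_cases hv : v = 0
  · subst hv
    have : Real.exp (-(a - m) ^ 2 / (2 * ((0 : ℝ≥0) : ℝ))) = 1 := by simp
    rw [this]
    exact measureReal_le_one
  · have hv0 : 0 < (v : ℝ) := NNReal.coe_pos.mpr (pos_iff_ne_zero.mpr hv)
    set τ : ℝ := (a - m) / v with hτ
    have hτ0 : 0 ≤ τ := div_nonneg (sub_nonneg.mpr ha) hv0.le
    have h := measure_ge_le_exp_cgf (μ := gaussianReal m v) (X := fun x => x) a hτ0 (integrable_exp_mul_gaussianReal τ)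
    rw [cgf_gaussianReal (μ := m) (v := v) (X := fun x => x) (by simp)] at h
    refine h.trans (le_of_eq ?_)
    congr 1
    rw [hτ]
    field_simp
    ring

/-- Lower Gaussian tail: for `−a ≤ m`, `γ_{m,v}{x : x ≤ −a} ≤ e^{−(a+m)²/(2v)}` (Chernoff at `τ = −(a+m)/v`).
[cite: BalabanImbrieJaffe1988, (5.14.4) p.309] -/
theorem gaussianReal_real_le_neg_le (m : ℝ) (v : ℝ≥0) {a : ℝ} (ha : -a ≤ m) :
    (gaussianReal m v).real {x | x ≤ -a} ≤ Real.exp (-(a + m) ^ 2 / (2 * v)) := by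
  by_cases hv : v = 0
  · subst hv
    have : Real.exp (-(a + m) ^ 2 / (2 * ((0 : ℝ≥0) : ℝ))) = 1 := by simp
    rw [this]
    exact measureReal_le_one
  · have hv0 : 0 < (v : ℝ) := NNReal.coe_pos.mpr (pos_iff_ne_zero.mpr hv)
    set τ : ℝ := -(a + m) / v with hτ
    have hτ0 : τ ≤ 0 := div_nonpos_of_nonpos_of_nonneg (by linarith) hv0.le
    have h := measure_le_le_exp_cgf (μ := gaussianReal m v) (X := fun x => x) (-a) hτ0 (integrable_exp_mul_gaussianReal τ)
    rw [cgf_gaussianReal (μ := m) (v := v) (X := fun x => x) (by simp)] at h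
    refine h.trans (le_of_eq ?_)
    congr 1
    rw [hτ]
    field_simp
    ring

/-- **Two-sided Gaussian tail**: for `|m| ≤ a`, `γ_{m,v}{x : a ≤ |x|} ≤ 2e^{−(a−|m|)²/(2v)}`.
[cite: BalabanImbrieJaffe1988, (5.14.4) p.309] -/
theorem gaussianReal_real_abs_ge_le (m : ℝ) (v : ℝ≥0) {a : ℝ} (ha : |m| ≤ a) :
    (gaussianReal m v).real {x | a ≤ |x|} ≤ 2 * Real.exp (-(a - |m|) ^ 2 / (2 * v)) := by
  have hma : m ≤ a := (le_abs_self m).trans ha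
  have hma' : -a ≤ m := by have := neg_abs_le m; linarith
  have hsub : {x : ℝ | a ≤ |x|} ⊆ {x | a ≤ x} ∪ {x | x ≤ -a} := by
    intro x hx
    have hx' : a ≤ |x| := hx
    rcases le_abs.mp hx' with h | h
    · exact Or.inl h
    · exact Or.inr (by simp only [Set.mem_setOf_eq]; linarith)
  have h0 : 0 ≤ a - |m| := sub_nonneg.mpr ha
  have hv2 : 0 ≤ 2 * (v : ℝ) := by positivity
  -- each one-sided exponent is at least as negative as −(a−|m|)²/(2v)
  have hup : Real.exp (-(a - m) ^ 2 / (2 * v)) ≤ Real.exp (-(a - |m|) ^ 2 / (2 * v)) := by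
    apply Real.exp_le_exp.mpr
    rw [neg_div, neg_div, neg_le_neg_iff]
    apply div_le_div_of_nonneg_right _ hv2
    exact pow_le_pow_left₀ h0 (by linarith [le_abs_self m]) 2
  have hlo : Real.exp (-(a + m) ^ 2 / (2 * v)) ≤ Real.exp (-(a - |m|) ^ 2 / (2 * v)) := by
    apply Real.exp_le_exp.mpr
    rw [neg_div, neg_div, neg_le_neg_iff]
    apply div_le_div_of_nonneg_right _ hv2
    exact pow_le_pow_left₀ h0 (by linarith [neg_abs_le m]) 2
  calc (gaussianReal m v).real {x | a ≤ |x|}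
      ≤ (gaussianReal m v).real ({x | a ≤ x} ∪ {x | x ≤ -a}) := measureReal_mono hsub
    _ ≤ (gaussianReal m v).real {x | a ≤ x} + (gaussianReal m v).real {x | x ≤ -a} := measureReal_union_le _ _
    _ ≤ Real.exp (-(a - |m|) ^ 2 / (2 * v)) + Real.exp (-(a - |m|) ^ 2 / (2 * v)) :=
        add_le_add ((gaussianReal_real_ge_le m v hma).trans hup) ((gaussianReal_real_le_neg_le m v hma').trans hlo)
    _ = 2 * Real.exp (-(a - |m|) ^ 2 / (2 * v)) := by ring

end Tails

/-! ## §2 *"After integration over A^{(k)}, we obtain factors ct^{−n}e^{−cp(te_k)²}"* -/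

section Integration

variable (χ : CutoffProfile)

/-- **p. 309, the Gaussian integration (model instance: one Gaussian variable of mean `m`, variance `v`)**: for `n ≥ 1` there is
`C = C(χ,p,n) ≥ 0` (the constant of `BIJ88ChiTDerivN309.exists_abs_iteratedDeriv_cutoff_t_le_indicator`) such that for all `c ≠ 0`,
`0 < e_k`, `0 < t`, `te_k ≤ e^{−1}` and every Gaussian law `γ_{m,v}` with `|m| ≤ (9/10)|c|p(te_k)`:
`∫ |(d/dt)ⁿ χ(c·p(te_k), A)| dγ_{m,v}(A) ≤ 2C · t^{−n} · e^{−((9/10)|c|p(te_k) − |m|)²/(2v)}`. [cite: BalabanImbrieJaffe1988, (5.14.4) p.309] -/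
theorem exists_integral_abs_iteratedDeriv_cutoff_t_le (p : ℝ) {n : ℕ} (hn : 1 ≤ n) :
    ∃ C : ℝ, 0 ≤ C ∧ ∀ (m : ℝ) (v : ℝ≥0) ⦃c ek t : ℝ⦄, c ≠ 0 → 0 < ek → 0 < t → t * ek ≤ Real.exp (-1) →
      |m| ≤ 9 / 10 * (|c| * pLog p (t * ek)) →
        ∫ A, |iteratedDeriv n (fun s => cutoff χ (c * pLog p (s * ek)) A) t| ∂(gaussianReal m v) ≤
          2 * C * t ^ (-(n : ℤ)) * Real.exp (-(9 / 10 * (|c| * pLog p (t * ek)) - |m|) ^ 2 / (2 * v)) := by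
  obtain ⟨C, hC0, hC⟩ := BIJ88ChiTDerivN309.exists_abs_iteratedDeriv_cutoff_t_le_indicator χ p hn
  refine ⟨C, hC0, fun m v c ek t hc hek ht h1 hm => ?_⟩
  set a : ℝ := 9 / 10 * (|c| * pLog p (t * ek)) with ha
  set S : Set ℝ := {A | a ≤ |A|} with hS
  have hSm : MeasurableSet S := measurableSet_le measurable_const continuous_abs.measurable
  have htz : 0 ≤ t ^ (-(n : ℤ)) := (zpow_pos ht _).le
  set K : ℝ := t ^ (-(n : ℤ)) * C with hK
  have hK0 : 0 ≤ K := mul_nonneg htz hC0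
  -- pointwise: |∂ⁿχ| ≤ 𝟙_S · K
  have hpt : ∀ A, |iteratedDeriv n (fun s => cutoff χ (c * pLog p (s * ek)) A) t| ≤ S.indicator (fun _ => K) A := by
    intro A
    refine (hC A hc hek ht h1).trans ?_
    by_cases hA : A ∈ S
    · rw [Set.indicator_of_mem hA]
      refine mul_le_mul_of_nonneg_left ?_ htz
      rcases Set.indicator_eq_zero_or_self (Set.Icc (9 / 10 * (|c| * pLog p (t * ek))) (|c| * pLog p (t * ek)))
        (fun _ => (1 : ℝ)) |A| with h | h
      · rw [h, mul_zero]; exact hC0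
      · rw [h, mul_one]
    · have hA' : |A| ∉ Set.Icc (9 / 10 * (|c| * pLog p (t * ek))) (|c| * pLog p (t * ek)) := fun h => hA h.1
      rw [Set.indicator_of_notMem hA, Set.indicator_of_notMem hA', mul_zero, mul_zero]
  have hint : Integrable (S.indicator fun _ => K) (gaussianReal m v) := (integrable_const K).indicator hSm
  calc ∫ A, |iteratedDeriv n (fun s => cutoff χ (c * pLog p (s * ek)) A) t| ∂(gaussianReal m v)
      ≤ ∫ A, S.indicator (fun _ => K) A ∂(gaussianReal m v) :=
        integral_mono_of_nonneg (Filter.Eventually.of_forall fun A => abs_nonneg _) hint (Filter.Eventually.of_forall hpt)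
    _ = (gaussianReal m v).real S * K := by rw [integral_indicator_const K hSm, smul_eq_mul]
    _ ≤ 2 * Real.exp (-(a - |m|) ^ 2 / (2 * v)) * K :=
        mul_le_mul_of_nonneg_right (gaussianReal_real_abs_ge_le m v hm) hK0
    _ = 2 * C * t ^ (-(n : ℤ)) * Real.exp (-(a - |m|) ^ 2 / (2 * v)) := by rw [hK]; ring

/-- **The centered case** (`m = 0`): `∫ |(d/dt)ⁿ χ(c·p(te_k), A)| dγ_{0,v}(A) ≤ (2C)/tⁿ · e^{−((81/200)c²/v)·p(te_k)²}` — the printed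
`ct^{−n}e^{−cp(te_k)²}` with both constants explicit (`2C(χ,p,n)` and `81c²/(200v)`). [cite: BalabanImbrieJaffe1988, (5.14.4) p.309] -/
theorem exists_integral_abs_iteratedDeriv_cutoff_t_le_centered (p : ℝ) {n : ℕ} (hn : 1 ≤ n) :
    ∃ C : ℝ, 0 ≤ C ∧ ∀ (v : ℝ≥0) ⦃c ek t : ℝ⦄, c ≠ 0 → 0 < ek → 0 < t → t * ek ≤ Real.exp (-1) →
      ∫ A, |iteratedDeriv n (fun s => cutoff χ (c * pLog p (s * ek)) A) t| ∂(gaussianReal 0 v) ≤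
        2 * C / t ^ n * Real.exp (-(81 / 200 * c ^ 2 / v * pLog p (t * ek) ^ 2)) := by
  obtain ⟨C, hC0, hC⟩ := exists_integral_abs_iteratedDeriv_cutoff_t_le χ p hn
  refine ⟨C, hC0, fun v c ek t hc hek ht h1 => ?_⟩
  have hP : 0 ≤ |c| * pLog p (t * ek) := by
    have htek : 0 < t * ek := mul_pos ht hek
    have h1' : t * ek < 1 := h1.trans_lt (by rw [← Real.exp_zero]; exact Real.exp_lt_exp.mpr (by norm_num))
    have hL : 0 < -Real.log (t * ek) := by have := Real.log_neg htek h1'; linarith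
    rw [BIJ88ChiTDeriv309.pLog_eq_rpow_neg_log p htek h1']
    exact mul_nonneg (abs_nonneg c) (Real.rpow_pos_of_pos hL p).le
  have h := hC 0 v hc hek ht h1 (by rw [abs_zero]; positivity)
  refine h.trans (le_of_eq ?_)
  rw [abs_zero, sub_zero, zpow_neg, zpow_natCast, div_eq_mul_inv]
  congr 2
  rw [mul_pow, mul_pow, sq_abs]
  ring

/-- **The whole sentence** *"After integration over A^{(k)}, we obtain factors ct^{−n}e^{−cp(te_k)²} ≤ (e^β(L^kε/ε₀)^{1/4−α})ⁿ"*, model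
instance (centered Gaussian variable of variance `v`, charge reading of `e^β`): `BIJ88GaussFactor309.gauss309` applied to the centered bound,
with `L^kε = sε₀`, `0 < s ≤ 1`, `0 < ε₀ ≤ 1`, `0 < e ≤ 1`, `β ≤ 1`, `0 ≤ α`, `d < 4`, `1/2 < p`, `0 < t ≤ 1`, and the printed small-coupling
regime `n + 1 ≤ (81c²/(200v))|log e_k⁻¹|^{2p−1}`, `2C·e_k ≤ 1`, `e_k ≤ e^{−1}`. [cite: BalabanImbrieJaffe1988, (5.14.4) p.309] -/
theorem exists_integral_le_vertexFactor_pow (p : ℝ) {n : ℕ} (hn : 1 ≤ n) :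
    ∃ C : ℝ, 0 ≤ C ∧ ∀ (v : ℝ≥0) ⦃L ε e s ε₀ t c α β : ℝ⦄ ⦃d k : ℕ⦄, 0 < L → 0 < ε → 0 < e → e ≤ 1 → β ≤ 1 → 0 ≤ α → d < 4 →
      0 < s → s ≤ 1 → 0 < ε₀ → ε₀ ≤ 1 → L ^ k * ε = s * ε₀ → 0 < t → t ≤ 1 → 1 / 2 < p → c ≠ 0 →
      eK L ε e d k ≤ Real.exp (-1) →
      (n : ℝ) + 1 ≤ 81 / 200 * c ^ 2 / v * Real.log (eK L ε e d k)⁻¹ ^ (2 * p - 1) → 2 * C * eK L ε e d k ≤ 1 →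
        ∫ A, |iteratedDeriv n (fun σ => cutoff χ (c * pLog p (σ * eK L ε e d k)) A) t| ∂(gaussianReal 0 v) ≤
          (e ^ β * s ^ (1 / 4 - α)) ^ n := by
  obtain ⟨C, hC0, hC⟩ := exists_integral_abs_iteratedDeriv_cutoff_t_le_centered χ p hn
  refine ⟨C, hC0, ?_⟩
  intro v L ε e s ε₀ t c α β d k hL hε he0 he1 hβ1 hα hd hs0 hs1 hε₀0 hε₀1 hLε ht0 ht1 hp hc hek1 hreg hsmall
  have hek : 0 < eK L ε e d k := BIJ88ScaleSums.eK_pos hL hε he0 k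
  have h1 : t * eK L ε e d k ≤ Real.exp (-1) :=
    (mul_le_of_le_one_left hek.le ht1).trans hek1
  refine (hC v hc hek ht0 h1).trans ?_
  exact BIJ88GaussFactor309.gauss309 hL hε he0 he1 hβ1 hα hd hs0 hs1 hε₀0 hε₀1 hLε ht0 ht1 hp (by positivity) (by positivity)
    hreg hsmall

end Integration

end Literature.MathematicalPhysics.QuantumFieldTheory.BalabanImbrieJaffe1984to88.BIJ88GaussIntegration309
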